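import Summits.HubbardSuperconductivity.HubbardSuperconductivity.Theorems.AnisotropyChordFourTorusCertificateX
import Summits.HubbardSuperconductivity.HubbardSuperconductivity.Theorems.AnisotropyChordFourTorusKernelCertZ
import Summits.HubbardSuperconductivity.HubbardSuperconductivity.Theorems.AnisotropyChordFourTorusSymForms

/-!
# Route `AnisotropyChord` / crux `ChordXY` at `M = 4`: SYMMETRIC TRIAL STATES on the `4 × 4` torus and their Rayleigh–Ritz bounds
# (prover seat `hubbard-h0-rotor-p1` g18)

A class vector `w : ℕ → ℕ` that depends only on the two class invariants `(A_r, B_r)` (anti-aligned nearest-neighbour / distance-2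
ordered pairs of the representative) defines the amplitude `trialAmp w σ = w (cls (code σ))` on the sector `Sᶻ_tot = 0`, which is
SYMMETRIC (`trialAmp_symAmp`: the invariants are automorphism- and flip-invariant class functions), so its norm and energy are the
reduced forms `N(w)`, `A(w) + (1−Δ)W(w)` (`…FourTorusSymForms`), and Rayleigh–Ritz (`rayleigh_real`) bounds the sector ground energy:
`(E₀(Δ) + 8)·N(w) ≤ A(w) + (1−Δ)·W(w)`.  Instances with the kernel vectors `wa` (`Δ = 0`) and `wb` (`Δ = −1`, `Δ = −17/200`):
`rr_zero : (E₀(0)+8)·(4·nac) ≤ eac`, `rr_negOne : (E₀(−1)+8)·(4·nbc) ≤ ebm`, `rr_junction : (E₀(−17/200)+8)·(48000·nbc) ≤ ebj`.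
Also: the distance-2 invariant `brokenOrd2` (definition, automorphism/flip invariance, class function, kernel literal `bLit`).
-/

set_option linter.style.longLine false
set_option linter.dupNamespace false
set_option autoImplicit false

open Finset
open Literature.MathematicalPhysics.QuantumLattice Literature.Probability.LatticeModels
open Summit.HubbardSuperconductivity.HubbardSuperconductivity.Theorems.AnisotropyChord.Tower
open Summit.HubbardSuperconductivity.HubbardSuperconductivity.Theorems.AnisotropyChord.InsertionEntropy

namespace Summit.HubbardSuperconductivity.HubbardSuperconductivity.Theorems.AnisotropyChord.FourTorus

/-! ## The distance-2 invariant -/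

section General
variable {V : Type} [Fintype V] [DecidableEq V] (G : SimpleGraph V) [DecidableRel G.Adj]

/-- `x, y` at graph distance exactly two: distinct, non-adjacent, with a common neighbour. [folklore] -/
def DistTwo (x y : V) : Prop := x ≠ y ∧ ¬ G.Adj x y ∧ ∃ z, G.Adj x z ∧ G.Adj z y

/-- `DistTwo` is decidable on a finite graph with decidable adjacency. [folklore] -/
instance instDecidableDistTwo (x y : V) : Decidable (DistTwo G x y) := by unfold DistTwo; infer_instance

/-- ordered count of anti-aligned distance-2 pairs (`σ x = 0`, `σ y = 1`). [folklore] -/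
noncomputable def brokenOrd2 (σ : V → Fin 2) : ℝ := ∑ x, ∑ y, if DistTwo G x y ∧ σ x = 0 ∧ σ y = 1 then (1:ℝ) else 0

omit [Fintype V] [DecidableEq V] [DecidableRel G.Adj] in
/-- distance two is preserved by automorphisms. [folklore] -/
theorem distTwo_map_iff (φ : G ≃g G) (x y : V) : DistTwo G (φ x) (φ y) ↔ DistTwo G x y := by
  unfold DistTwo
  rw [φ.map_adj_iff, φ.injective.ne_iff]
  constructor
  · rintro ⟨h1, h2, z, hz1, hz2⟩
    refine ⟨h1, h2, φ.symm z, ?_, ?_⟩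
    · have := φ.symm.map_adj_iff.2 hz1; simpa using this
    · have := φ.symm.map_adj_iff.2 hz2; simpa using this
  · rintro ⟨h1, h2, z, hz1, hz2⟩
    exact ⟨h1, h2, φ z, φ.map_adj_iff.2 hz1, φ.map_adj_iff.2 hz2⟩

/-- `brokenOrd2` is invariant under graph automorphisms. [folklore] -/
theorem brokenOrd2_comp_iso (φ : G ≃g G) (σ : V → Fin 2) : brokenOrd2 G (σ ∘ ⇑φ) = brokenOrd2 G σ := by
  unfold brokenOrd2
  symm
  rw [← Equiv.sum_comp φ.toEquiv]
  refine Finset.sum_congr rfl fun x _ => ?_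
  rw [← Equiv.sum_comp φ.toEquiv]
  refine Finset.sum_congr rfl fun y _ => ?_
  have hd : DistTwo G (φ x) (φ y) ↔ DistTwo G x y := distTwo_map_iff G φ x y
  have hx : φ.toEquiv x = φ x := rfl
  have hy : φ.toEquiv y = φ y := rfl
  rw [hx, hy]
  by_cases h1 : DistTwo G x y <;> by_cases h2 : σ (φ x) = 0 <;> by_cases h3 : σ (φ y) = 1 <;>
    simp [Function.comp_apply, hd, h1, h2, h3]

omit [Fintype V] [DecidableEq V] [DecidableRel G.Adj] in
/-- distance two is symmetric. [folklore] -/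
theorem distTwo_comm (x y : V) : DistTwo G x y ↔ DistTwo G y x := by
  unfold DistTwo
  constructor
  · rintro ⟨h1, h2, z, hz1, hz2⟩; exact ⟨Ne.symm h1, fun h => h2 (G.adj_symm h), z, G.adj_symm hz2, G.adj_symm hz1⟩
  · rintro ⟨h1, h2, z, hz1, hz2⟩; exact ⟨Ne.symm h1, fun h => h2 (G.adj_symm h), z, G.adj_symm hz2, G.adj_symm hz1⟩

/-- `brokenOrd2` is invariant under the global flip (swap the roles of `x` and `y`). [folklore] -/
theorem brokenOrd2_flipAll (σ : V → Fin 2) : brokenOrd2 G (flipAll σ) = brokenOrd2 G σ := by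
  unfold brokenOrd2
  rw [Finset.sum_comm]
  refine Finset.sum_congr rfl fun y _ => Finset.sum_congr rfl fun x _ => ?_
  have hx : flipAll σ x = 0 ↔ σ x = 1 := flipAll_eq_zero_iff σ x
  have hy : flipAll σ y = 1 ↔ σ y = 0 := by
    rw [← flipAll_eq_zero_iff (flipAll σ) y, flipAll_flipAll]
  simp only [hx, hy, distTwo_comm G x y]
  by_cases h1 : DistTwo G y x <;> by_cases h2 : σ y = 0 <;> by_cases h3 : σ x = 1 <;> simp [h1, h2, h3, and_comm]

end General

/-- the kernel table `adj2` is graph distance two (through `siteEquiv`). [folklore] -/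
theorem adj2_iff (x y : V4) : adj2 (siteEquiv x) (siteEquiv y) = true ↔ DistTwo (torusGraph 2 4) x y := by
  -- `adj2` against the `adj16`-expression, from the kernel fact `adj2_spec`
  have hspec : ∀ i < 16, ∀ j < 16, adj2 i j = (!(i == j) && !(adj16 i j) && !(allN 16 fun l => !(adj16 i l && adj16 l j))) := by
    intro i hi j hj
    have := allN_sound (allN_sound adj2_spec i hi) j hj
    rwa [beq_iff_eq] at this
  have key : ∀ i j : Fin 16, (!(((i:ℕ)) == (j:ℕ)) && !(adj16 i j) && !(allN 16 fun l => !(adj16 i l && adj16 l j))) = true ↔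
      DistTwo (torusGraph 2 4) (siteEquiv.symm i) (siteEquiv.symm j) := by
    intro i j
    unfold DistTwo
    have e1 : (!((i:ℕ) == (j:ℕ))) = true ↔ siteEquiv.symm i ≠ siteEquiv.symm j := by
      rw [Bool.not_eq_true', beq_eq_false_iff_ne, ne_eq, Fin.val_inj]
      exact siteEquiv.symm.injective.ne_iff.symm
    have e2 : (!(adj16 i j)) = true ↔ ¬ (torusGraph 2 4).Adj (siteEquiv.symm i) (siteEquiv.symm j) := by
      rw [Bool.not_eq_true', ← adj16_iff, Equiv.apply_symm_apply, Equiv.apply_symm_apply, Bool.eq_false_iff]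
    have e3 : (!(allN 16 fun l => !(adj16 i l && adj16 l j))) = true ↔
        ∃ z, (torusGraph 2 4).Adj (siteEquiv.symm i) z ∧ (torusGraph 2 4).Adj z (siteEquiv.symm j) := by
      rw [Bool.not_eq_true']
      constructor
      · intro h
        by_contra hne
        push Not at hne
        have hall : (allN 16 fun l => !(adj16 i l && adj16 l j)) = true := by
          -- every `l` fails, so the conjunction loop is `true`
          have hl : ∀ l < 16, (!(adj16 i l && adj16 l j)) = true := by
            intro l hl
            rw [Bool.not_eq_true', Bool.and_eq_false_iff]
            by_contra hb
            push Not at hb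
            obtain ⟨h1, h2⟩ := hb
            have h1' : (torusGraph 2 4).Adj (siteEquiv.symm i) (siteEquiv.symm ⟨l, hl⟩) := by
              rw [← adj16_iff]; simpa using h1
            have h2' : (torusGraph 2 4).Adj (siteEquiv.symm ⟨l, hl⟩) (siteEquiv.symm j) := by
              rw [← adj16_iff]; simpa using h2
            exact hne _ h1' h2'
          unfold allN
          clear h hne
          suffices H : ∀ n ≤ 16, iter n (fun l ok => ok && !(adj16 i l && adj16 l j)) true = true from H 16 le_rfl
          intro n hn
          induction n with
          | zero => rfl
          | succ n ih =>
            rw [iter_succ, hl n (by omega), Bool.true_and]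
            exact ih (by omega)
        rw [hall] at h; exact Bool.noConfusion h
      · rintro ⟨z, hz1, hz2⟩
        by_contra hne
        have hne' : (allN 16 fun l => !(adj16 i l && adj16 l j)) = true := by
          cases hb : (allN 16 fun l => !(adj16 i l && adj16 l j)) with
          | true => rfl
          | false => exact absurd hb hne
        have := allN_sound hne' (siteEquiv z) (siteEquiv z).isLt
        rw [Bool.not_eq_true', Bool.and_eq_false_iff] at this
        rcases this with h | h
        · have : adj16 (siteEquiv (siteEquiv.symm i)) (siteEquiv z) = true := (adj16_iff _ _).2 hz1
          rw [Equiv.apply_symm_apply] at this; rw [this] at h; exact Bool.noConfusion h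
        · have : adj16 (siteEquiv z) (siteEquiv (siteEquiv.symm j)) = true := (adj16_iff _ _).2 hz2
          rw [Equiv.apply_symm_apply] at this; rw [this] at h; exact Bool.noConfusion h
    rw [Bool.and_eq_true, Bool.and_eq_true, e1, e2, e3]
    tauto
  have := key (siteEquiv x) (siteEquiv y)
  rw [Equiv.symm_apply_apply, Equiv.symm_apply_apply] at this
  rw [← this, hspec _ (siteEquiv x).isLt _ (siteEquiv y).isLt]

/-- **the distance-2 count of a weight-8 code is that of its class representative.** [folklore] -/
theorem brokenOrd2_decode_class {k : ℕ} (hk : k < 65536) (hpop : pop16 k = 8) :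
    brokenOrd2 (torusGraph 2 4) (decode k) = brokenOrd2 (torusGraph 2 4) (decode (rep8 (cls k))) := by
  obtain ⟨-, hw, hact⟩ := check8_facts hk hpop
  conv_lhs => rw [← hact]
  rcases Nat.mod_two_eq_zero_or_one (wit8 k) with he | ho
  · rw [decode_actCode_even hw he]
    exact brokenOrd2_comp_iso _ (siteIso (wit8 k / 32) ((wit8 k / 2) % 16) (Nat.div_lt_of_lt_mul hw) (Nat.mod_lt _ (Nat.succ_pos 15))).symm _
  · rw [decode_actCode_odd hw ho, brokenOrd2_flipAll]
    exact brokenOrd2_comp_iso _ (siteIso (wit8 k / 32) ((wit8 k / 2) % 16) (Nat.div_lt_of_lt_mul hw) (Nat.mod_lt _ (Nat.succ_pos 15))).symm _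

/-- at a code the distance-2 count is the kernel loop. [folklore] -/
theorem brokenOrd2_decode_eq (u : ℕ) :
    brokenOrd2 (torusGraph 2 4) (decode u)
      = ((sumN 16 fun i => sumN 16 fun j => bif adj2 i j && !(Nat.testBit u i) && Nat.testBit u j then 1 else 0 : ℕ) : ℝ) := by
  unfold brokenOrd2
  rw [sumN_eq]; simp_rw [sumN_eq]
  push_cast
  rw [← sum_V4_eq]
  refine Finset.sum_congr rfl fun x _ => ?_
  rw [← sum_V4_eq]
  refine Finset.sum_congr rfl fun y _ => ?_
  simp only [decode_eq_zero_iff, decode_eq_one_iff]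
  by_cases h : DistTwo (torusGraph 2 4) x y
  · have hb : adj2 (siteEquiv x) (siteEquiv y) = true := (adj2_iff x y).2 h
    rw [hb]
    simp only [h, true_and, Bool.true_and]
    cases Nat.testBit u (siteEquiv x) <;> cases Nat.testBit u (siteEquiv y) <;> simp
  · have hb : adj2 (siteEquiv x) (siteEquiv y) = false := by
      cases h' : adj2 (siteEquiv x) (siteEquiv y)
      · rfl
      · exact absurd ((adj2_iff x y).1 h') h
    rw [hb]
    simp [h]

/-- `bLit r = brokenOrd2 (decode (rep8 r))` for `r < 58`. [folklore] -/
theorem bLit_eq {r : ℕ} (hr : r < 58) : (bLit r : ℝ) = brokenOrd2 (torusGraph 2 4) (decode (rep8 r)) := by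
  have h := allN_sound bAgree r hr
  rw [beq_iff_eq] at h
  rw [← h]; unfold dist2Count; rw [brokenOrd2_decode_eq]

/-! ## Symmetric trial amplitudes -/

/-- the code of a configuration. [folklore] -/
def code (σ : Cfg) : ℕ := (codeEquiv σ : ℕ)

/-- `code σ < 2^16`. [folklore] -/
theorem code_lt (σ : Cfg) : code σ < 65536 := (codeEquiv σ).isLt

/-- `decode (code σ) = σ`. [folklore] -/
theorem decode_code (σ : Cfg) : decode (code σ) = σ := by
  unfold code; rw [← codeEquiv_symm_eq_decode, Equiv.symm_apply_apply]

/-- `code (decode k) = k` for `k < 2^16`. [folklore] -/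
theorem code_decode {k : ℕ} (hk : k < 65536) : code (decode k) = k := by
  have h := codeEquiv_symm_eq_decode ⟨k, hk⟩
  unfold code
  rw [← h, Equiv.apply_symm_apply]

/-- the amplitude on the sector `Sᶻ_tot = 0` with class values `w`. [folklore] -/
noncomputable def trialAmp (w : ℕ → ℕ) (σ : Cfg) : ℝ := if pop16 (code σ) = 8 then (w (cls (code σ)) : ℝ) else 0

/-- `trialAmp w (decode k) = [pop16 k = 8] · w (cls k)`. [folklore] -/
theorem trialAmp_decode (w : ℕ → ℕ) {k : ℕ} (hk : k < 65536) :
    trialAmp w (decode k) = if pop16 k = 8 then (w (cls k) : ℝ) else 0 := by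
  unfold trialAmp; rw [code_decode hk]

/-- the class invariants `(aLit, bLit)` agree along an automorphism or the flip (weight-8 codes). [folklore] -/
theorem invariants_eq {k k' : ℕ} (hk : k < 65536) (hk' : k' < 65536) (hp : pop16 k = 8) (hp' : pop16 k' = 8)
    (hA : brokenOrd (torusGraph 2 4) (decode k') = brokenOrd (torusGraph 2 4) (decode k))
    (hB : brokenOrd2 (torusGraph 2 4) (decode k') = brokenOrd2 (torusGraph 2 4) (decode k)) :
    aLit (cls k') = aLit (cls k) ∧ bLit (cls k') = bLit (cls k) := by
  have hc := (check8_facts hk hp).1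
  have hc' := (check8_facts hk' hp').1
  constructor
  · have h1 : (aLit (cls k') : ℝ) = (aLit (cls k) : ℝ) := by
      rw [aLit_eq hc, aLit_eq hc', activeEdges_eq, activeEdges_eq, ← brokenOrd_decode_class hk hp,
        ← brokenOrd_decode_class hk' hp', hA]
    exact_mod_cast h1
  · have h1 : (bLit (cls k') : ℝ) = (bLit (cls k) : ℝ) := by
      rw [bLit_eq hc, bLit_eq hc', ← brokenOrd2_decode_class hk hp, ← brokenOrd2_decode_class hk' hp', hB]
    exact_mod_cast h1

/-- a class vector that is a function of `(aLit, bLit)`. [folklore] -/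
def SigInvariant (w : ℕ → ℕ) : Prop := ∀ r < 58, ∀ s < 58, aLit r = aLit s → bLit r = bLit s → w r = w s

/-- `pop16` through `zerosCard`: `pop16 (code σ) = 8 ↔ zerosCard σ = 8`. [folklore] -/
theorem pop16_code_iff (σ : Cfg) : pop16 (code σ) = 8 ↔ zerosCard σ = 8 := by
  rw [← zerosCard_decode_eq_eight_iff (code_lt σ), decode_code]

/-- **a `SigInvariant` class vector gives a SYMMETRIC trial amplitude.** [folklore] -/
theorem trialAmp_symAmp {w : ℕ → ℕ} (hw : SigInvariant w) : SymAmp (trialAmp w) where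
  perm := by
    intro p m hp hm σ
    set k := code σ with hkdef
    have hk : k < 65536 := code_lt σ
    have hσ : σ = decode k := (decode_code σ).symm
    have hσ' : σ ∘ ⇑(sitePerm p m hp hm).symm = decode (moveBits p m k) := by rw [decode_moveBits hp hm, ← hσ]
    rw [hσ', hσ, trialAmp_decode w hk, trialAmp_decode w (moveBits_lt hp hm k)]
    have hz : zerosCard (decode (moveBits p m k)) = zerosCard (decode k) := by
      rw [decode_moveBits hp hm]; exact zerosCard_comp_perm _ _
    by_cases h8 : pop16 k = 8
    · have h8' : pop16 (moveBits p m k) = 8 := by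
        rw [← zerosCard_decode_eq_eight_iff (moveBits_lt hp hm k), hz, zerosCard_decode_eq_eight_iff hk]; exact h8
      rw [if_pos h8, if_pos h8']
      have hA : brokenOrd (torusGraph 2 4) (decode (moveBits p m k)) = brokenOrd (torusGraph 2 4) (decode k) := by
        rw [decode_moveBits hp hm]; exact brokenOrd_comp_iso _ (siteIso p m hp hm).symm _
      have hB : brokenOrd2 (torusGraph 2 4) (decode (moveBits p m k)) = brokenOrd2 (torusGraph 2 4) (decode k) := by
        rw [decode_moveBits hp hm]; exact brokenOrd2_comp_iso _ (siteIso p m hp hm).symm _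
      obtain ⟨ha, hb⟩ := invariants_eq hk (moveBits_lt hp hm k) h8 h8' hA hB
      exact_mod_cast hw _ (check8_facts (moveBits_lt hp hm k) h8').1 _ (check8_facts hk h8).1 ha hb
    · have h8' : ¬ pop16 (moveBits p m k) = 8 := by
        rw [← zerosCard_decode_eq_eight_iff (moveBits_lt hp hm k), hz, zerosCard_decode_eq_eight_iff hk]; exact h8
      rw [if_neg h8, if_neg h8']
  flip := by
    intro σ
    set k := code σ with hkdef
    have hk : k < 65536 := code_lt σ
    have hσ : σ = decode k := (decode_code σ).symm
    have hσ' : flipAll σ = decode (k ^^^ 65535) := by rw [decode_flipMask, ← hσ]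
    rw [hσ', hσ, trialAmp_decode w hk, trialAmp_decode w (flipMask_lt hk)]
    have hz8 : zerosCard (decode (k ^^^ 65535)) = 8 ↔ zerosCard (decode k) = 8 := by
      rw [decode_flipMask, zerosCard_flipAll, card_V4]; constructor <;> intro h <;> · push_cast at h ⊢; linarith
    by_cases h8 : pop16 k = 8
    · have h8' : pop16 (k ^^^ 65535) = 8 := by
        rw [← zerosCard_decode_eq_eight_iff (flipMask_lt hk), hz8, zerosCard_decode_eq_eight_iff hk]; exact h8
      rw [if_pos h8, if_pos h8']
      have hA : brokenOrd (torusGraph 2 4) (decode (k ^^^ 65535)) = brokenOrd (torusGraph 2 4) (decode k) := by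
        rw [decode_flipMask]; exact brokenOrd_flipAll _ _
      have hB : brokenOrd2 (torusGraph 2 4) (decode (k ^^^ 65535)) = brokenOrd2 (torusGraph 2 4) (decode k) := by
        rw [decode_flipMask]; exact brokenOrd2_flipAll _ _
      obtain ⟨ha, hb⟩ := invariants_eq hk (flipMask_lt hk) h8 h8' hA hB
      exact_mod_cast hw _ (check8_facts (flipMask_lt hk) h8').1 _ (check8_facts hk h8).1 ha hb
    · have h8' : ¬ pop16 (k ^^^ 65535) = 8 := by
        rw [← zerosCard_decode_eq_eight_iff (flipMask_lt hk), hz8, zerosCard_decode_eq_eight_iff hk]; exact h8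
      rw [if_neg h8, if_neg h8']
  supp := by
    intro σ hσ
    unfold trialAmp at hσ
    by_cases h8 : pop16 (code σ) = 8
    · exact (pop16_code_iff σ).1 h8
    · rw [if_neg h8] at hσ; exact absurd rfl hσ

/-- the class values of a trial amplitude are `w`. [folklore] -/
theorem trialAmp_classValues (w : ℕ → ℕ) {r : ℕ} (hr : r < 58) : trialAmp w (decode (rep8 r)) = (w r : ℝ) := by
  have h := allN_sound rep8_spec r hr
  simp only [Bool.and_eq_true, beq_iff_eq, decide_eq_true_eq] at h
  obtain ⟨⟨hp, hc⟩, hlt⟩ := h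
  rw [trialAmp_decode w hlt, if_pos hp, hc]

/-- the kernel's `sigAgree` says `wa`, `wb` are `SigInvariant`. [folklore] -/
theorem sigInvariant_wa_wb : SigInvariant wa ∧ SigInvariant wb := by
  have key : ∀ r < 58, ∀ s < 58, aLit r = aLit s → bLit r = bLit s → wa r = wa s ∧ wb r = wb s := by
    intro r hr s hs ha hb
    have h := allN_sound (allN_sound sigAgree r hr) s hs
    rw [ha, hb] at h
    simpa [Bool.or_eq_true, beq_iff_eq] using h
  exact ⟨fun r hr s hs ha hb => (key r hr s hs ha hb).1, fun r hr s hs ha hb => (key r hr s hs ha hb).2⟩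

/-! ## Rayleigh–Ritz with a symmetric trial amplitude -/

/-- reduced forms evaluated on an integer class vector equal the kernel scalars: norm. [folklore] -/
theorem normC_nat (w : ℕ → ℕ) : normC (fun r => (w r : ℝ)) = ((sumN 58 fun r => n8 r * w r * w r : ℕ) : ℝ) := by
  unfold normC; rw [sumN_eq]; push_cast; exact Finset.sum_congr rfl fun r _ => by ring

/-- reduced forms on an integer class vector: Ising diagonal `2·W(w) = Σ n8 (16 − A) w²`. [folklore] -/
theorem isingC_nat (w : ℕ → ℕ) :
    2 * isingC (fun r => (w r : ℝ)) = ((iter 58 (fun r acc => acc + (n8 r : ℤ) * (16 - (aLit r : ℤ)) * (w r : ℤ) * (w r : ℤ)) 0 : ℤ) : ℝ) := by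
  unfold isingC; rw [iter_add_eq, zero_add, Finset.mul_sum]; push_cast
  refine Finset.sum_congr rfl fun r hr => ?_
  rw [aLit_eq (mem_range.1 hr)]; ring

/-- reduced forms on an integer class vector: graph form `4·A(w) = wᵀ hLit w`. [folklore] -/
theorem hopC_nat (w : ℕ → ℕ) :
    4 * hopC (fun r => (w r : ℝ)) = ((iter 58 (fun r acc => acc + iter 58 (fun s acc2 => acc2 + (w r : ℤ) * (w s : ℤ) * hLit r s) 0) 0 : ℤ) : ℝ) := by
  rw [← quad_hLit, iter_add_eq, zero_add]; simp_rw [iter_add_eq, zero_add]; push_cast; rfl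

/-- **Rayleigh–Ritz with a symmetric trial amplitude:** `(E₀(Δ) + 8)·N(w) ≤ A(w) + (1−Δ)·W(w)`. [folklore] -/
theorem rayleigh_trial {w : ℕ → ℕ} (hw : SigInvariant w) (Δ : ℝ) :
    (lowestEnergyInSector 1 (xxzHamiltonian 1 (torusGraph 2 4) (-1) Δ) 0 + 8) * normC (fun r => (w r : ℝ))
      ≤ hopC (fun r => (w r : ℝ)) + (1 - Δ) * isingC (fun r => (w r : ℝ)) := by
  have hs := trialAmp_symAmp hw
  have hsupp : ∀ σ, trialAmp w σ ≠ 0 → zerosCard σ = (Fintype.card (TorusSite 2 4) : ℝ) / 2 + 0 := by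
    intro σ h; rw [hs.supp σ h, card_V4]; norm_num
  have hray := rayleigh_real (L := 4) Δ 0 (trialAmp w) hsupp
  rw [torus4_degree_sum] at hray
  obtain ⟨hN, hW, -, hA⟩ := hs.forms
  have hN' : ∑ σ, trialAmp w σ ^ 2 = normC (fun r => (w r : ℝ)) := by
    rw [hN]; unfold normC; exact Finset.sum_congr rfl fun r hr => by simp only [trialAmp_classValues w (mem_range.1 hr)]
  have hW' : ∑ σ, isingW (torusGraph 2 4) σ * trialAmp w σ ^ 2 = isingC (fun r => (w r : ℝ)) := by
    rw [hW]; unfold isingC; exact Finset.sum_congr rfl fun r hr => by simp only [trialAmp_classValues w (mem_range.1 hr)]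
  have hA' : ∑ σ, trialAmp w σ * fmOp (torusGraph 2 4) (trialAmp w) σ = hopC (fun r => (w r : ℝ)) := by
    rw [hA]; unfold hopC
    refine congrArg (fun s : ℝ => (1/4 : ℝ) * s) (Finset.sum_congr rfl fun ρ hρ => ?_)
    congr 1
    refine congrArg List.sum (List.map_congr_left fun pq hpq => ?_)
    obtain ⟨h1, h2⟩ := ordPairs_lt (mem_range.1 hρ) pq hpq
    simp only [trialAmp_classValues w h1, trialAmp_classValues w h2]
  have hsplit : ∑ σ, trialAmp w σ * (fmOp (torusGraph 2 4) (trialAmp w) σ + (1 - Δ) * (isingW (torusGraph 2 4) σ * trialAmp w σ))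
      = (∑ σ, trialAmp w σ * fmOp (torusGraph 2 4) (trialAmp w) σ) + (1 - Δ) * ∑ σ, isingW (torusGraph 2 4) σ * trialAmp w σ ^ 2 := by
    rw [Finset.mul_sum, ← Finset.sum_add_distrib]; exact Finset.sum_congr rfl fun σ _ => by ring
  rw [hsplit, hA', hW', hN'] at hray
  norm_num at hray ⊢
  linarith

/-- **`Δ = 0`:** `(E₀(0) + 8)·(4·nac) ≤ eac`. [folklore] -/
theorem rr_zero : (lowestEnergyInSector 1 (xxzHamiltonian 1 (torusGraph 2 4) (-1) 0) 0 + 8) * (4 * (nac : ℝ)) ≤ (eac : ℝ) := by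
  have h := rayleigh_trial sigInvariant_wa_wb.1 0
  have hn : normC (fun r => (wa r : ℝ)) = (nac : ℝ) := by rw [normC_nat]; unfold nac; push_cast; rfl
  have he : 4 * (hopC (fun r => (wa r : ℝ)) + (1 - 0) * isingC (fun r => (wa r : ℝ))) = (eac : ℝ) := by
    unfold eac hac wac; push_cast; rw [← hopC_nat, ← isingC_nat]; ring
  rw [hn] at h
  calc (lowestEnergyInSector 1 (xxzHamiltonian 1 (torusGraph 2 4) (-1) 0) 0 + 8) * (4 * (nac : ℝ))
      = 4 * ((lowestEnergyInSector 1 (xxzHamiltonian 1 (torusGraph 2 4) (-1) 0) 0 + 8) * (nac : ℝ)) := by ring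
    _ ≤ 4 * (hopC (fun r => (wa r : ℝ)) + (1 - 0) * isingC (fun r => (wa r : ℝ))) := by linarith
    _ = (eac : ℝ) := he

/-- **`Δ = −1`:** `(E₀(−1) + 8)·(4·nbc) ≤ ebm`. [folklore] -/
theorem rr_negOne : (lowestEnergyInSector 1 (xxzHamiltonian 1 (torusGraph 2 4) (-1) (-1)) 0 + 8) * (4 * (nbc : ℝ)) ≤ (ebm : ℝ) := by
  have h := rayleigh_trial sigInvariant_wa_wb.2 (-1)
  have hn : normC (fun r => (wb r : ℝ)) = (nbc : ℝ) := by rw [normC_nat]; unfold nbc; push_cast; rfl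
  have he : 4 * (hopC (fun r => (wb r : ℝ)) + (1 - (-1)) * isingC (fun r => (wb r : ℝ))) = (ebm : ℝ) := by
    unfold ebm hbc wbc; push_cast; rw [← hopC_nat, ← isingC_nat]; ring
  rw [hn] at h
  calc (lowestEnergyInSector 1 (xxzHamiltonian 1 (torusGraph 2 4) (-1) (-1)) 0 + 8) * (4 * (nbc : ℝ))
      = 4 * ((lowestEnergyInSector 1 (xxzHamiltonian 1 (torusGraph 2 4) (-1) (-1)) 0 + 8) * (nbc : ℝ)) := by ring
    _ ≤ 4 * (hopC (fun r => (wb r : ℝ)) + (1 - (-1)) * isingC (fun r => (wb r : ℝ))) := by linarith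
    _ = (ebm : ℝ) := he

/-- **`Δ = −17/200`:** `(E₀(−17/200) + 8)·(48000·nbc) ≤ ebj`. [folklore] -/
theorem rr_junction : (lowestEnergyInSector 1 (xxzHamiltonian 1 (torusGraph 2 4) (-1) (-17/200)) 0 + 8) * (48000 * (nbc : ℝ)) ≤ (ebj : ℝ) := by
  have h := rayleigh_trial sigInvariant_wa_wb.2 (-17/200)
  have hn : normC (fun r => (wb r : ℝ)) = (nbc : ℝ) := by rw [normC_nat]; unfold nbc; push_cast; rfl
  have he : 48000 * (hopC (fun r => (wb r : ℝ)) + (1 - (-17/200)) * isingC (fun r => (wb r : ℝ))) = (ebj : ℝ) := by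
    unfold ebj hbc wbc; push_cast; rw [← hopC_nat, ← isingC_nat]; ring
  rw [hn] at h
  calc (lowestEnergyInSector 1 (xxzHamiltonian 1 (torusGraph 2 4) (-1) (-17/200)) 0 + 8) * (48000 * (nbc : ℝ))
      = 48000 * ((lowestEnergyInSector 1 (xxzHamiltonian 1 (torusGraph 2 4) (-1) (-17/200)) 0 + 8) * (nbc : ℝ)) := by ring
    _ ≤ 48000 * (hopC (fun r => (wb r : ℝ)) + (1 - (-17/200)) * isingC (fun r => (wb r : ℝ))) := by linarith
    _ = (ebj : ℝ) := he

end Summit.HubbardSuperconductivity.HubbardSuperconductivity.Theorems.AnisotropyChord.FourTorus
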